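import Mathlib
import Summits.PneNP.PneNP.Theorems.PstarGraphQuadGap
import Summits.PneNP.PneNP.Theorems.PstarProductRank
import Summits.PneNP.PneNP.Theorems.PstarInducedMatching
import Summits.PneNP.PneNP.Theorems.PstarGraphQuadGapOne
import Summits.PneNP.PneNP.Theorems.PstarQuadBias
import Summits.PneNP.PneNP.Theorems.PstarGraphQuadGapTwoForms

/-!
# Two quadratic forms on a bounded-degree graph: the case analysis (ROUND-24 item T24.11c, part II)

FRONTIER range-avoidance ladder, rung F-N3, ROUND 24 (cell `pnp-ideate`; restricted-model proof complexity — nothing here bears on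
`P` versus `NP`).  Continues `PstarGraphQuadGapTwoForms` (packages, affine dichotomy) and proves the abstract bound
**`two_forms_bound : |E| ≤ 2Δ² · (2t + 3)`** for two quadratic functions `f_i = qform T_i + L_i + c_i` (`T_i ⊆ E`, `E` simple of
maximum degree `Δ`) that are never simultaneously `0` on a coset `b₀ + D` of codimension `≤ t` on which every edge of `E` is
necessary.  The by-name closer of `PstarGraphQuadGap.GraphQuadGapTwo` is the sequel `PstarGraphQuadGapTwo`.

Case analysis (see part I for the ingredients): the three packages `n₁, n₂, n₁₂ ≤ dim D` of `T₁, T₂, T₁ △ T₂` satisfy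
`2^{dim D} ≤ 2^{n₁} + 2^{n₂} + 2^{n₁₂}` (unsat identity + bias bounds), so (`pow_three_cases`) either a PAIR of forms has
`n + n' + 3 ≥ 2 dim D` — they cover `E`, `|E| ≤ 2Δ²(2V − n − n') ≤ 2Δ²(2t + 3)` — or ONE form has `n = dim D`, i.e. is affine on the
coset (`case_iso` for `T₁`, by symmetry for `T₂`; `case_iso_symmDiff` for `T₁ △ T₂`): its bias is then `0` (two-term recount,
`pow_two_cases`) or it is constant, and then edge-minimality confines `E` to one form with `D`-isotropic polar form.
-/

set_option linter.dupNamespace false -- `Summit.PneNP.PneNP.…`: summit = sub-problem name (D-0017 single-conjunct layout)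

open Finset Module
open scoped symmDiff
open Summit.PneNP.PneNP.Theorems.PstarProductRank
open Summit.PneNP.PneNP.Theorems.PstarGraphQuadGap
open Summit.PneNP.PneNP.Theorems.PstarGraphQuadGapOne
open Summit.PneNP.PneNP.Theorems.PstarQuadBias
open Summit.PneNP.PneNP.Theorems.PstarGraphQuadGapTwoForms

namespace Summit.PneNP.PneNP.Theorems.PstarGraphQuadGapTwoCases

/-- In `𝔽₂`, `x + x = 0`. -/
private theorem zmod2_add_self (x : ZMod 2) : x + x = 0 := by
  revert x; decide

/-- A non-zero element of `𝔽₂` is `1`. -/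
private theorem zmod2_eq_one_of_ne_zero {x : ZMod 2} (h : x ≠ 0) : x = 1 := by
  revert x h; decide

variable {V : ℕ} {E T₁ T₂ : Finset (Edge V)} {Δ t : ℕ} {D : Submodule (ZMod 2) (Fin V → ZMod 2)} {b₀ : Fin V → ZMod 2}
  {f₁ f₂ : (Fin V → ZMod 2) → ZMod 2} {L₁ L₂ : (Fin V → ZMod 2) →ₗ[ZMod 2] ZMod 2} {c₁ c₂ : ZMod 2}

/-- **The isotropic case for `T₁`.**  If `D` is isotropic for `B_{T₁}` then `|E| ≤ 2Δ²(2t + 3)`. -/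
theorem case_iso (hS : Simple E) (hΔ : EdgeMaxDegree Δ E) (hT₁E : T₁ ⊆ E) (hT₂E : T₂ ⊆ E)
    (𝒟 : Finset (Fin V → ZMod 2)) (h𝒟 : ∀ x, x ∈ 𝒟 ↔ x ∈ D) (hcodim : V ≤ finrank (ZMod 2) D + t)
    (hf₁ : ∀ x, f₁ x = qform T₁ Prod.fst Prod.snd x + L₁ x + c₁)
    (hf₂ : ∀ x, f₂ x = qform T₂ Prod.fst Prod.snd x + L₂ x + c₂)
    (hunsat : ∀ u ∈ D, f₁ (b₀ + u) ≠ 0 ∨ f₂ (b₀ + u) ≠ 0)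
    (hmin : ∀ j ∈ E, ∃ u ∈ D, (f₁ (b₀ + u) = 0 ↔ j ∉ T₁) ∧ (f₂ (b₀ + u) = 0 ↔ j ∉ T₂))
    (hD₁ : ∀ u ∈ D, ∀ v ∈ D, polar T₁ Prod.fst Prod.snd u v = 0) :
    E.card ≤ 2 * Δ ^ 2 * (2 * t + 3) := by
  classical
  have hdV : finrank (ZMod 2) D ≤ V := by simpa using Submodule.finrank_le D
  have hq₁ : ∀ x w, f₁ (x + w) = f₁ x + f₁ w - f₁ 0 + polar T₁ Prod.fst Prod.snd x w := by
    intro x w; simp only [hf₁]; exact quadratic_of_qform T₁ Prod.fst Prod.snd L₁ c₁ x w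
  have hq₂ : ∀ x w, f₂ (x + w) = f₂ x + f₂ w - f₂ 0 + polar T₂ Prod.fst Prod.snd x w := by
    intro x w; simp only [hf₂]; exact quadratic_of_qform T₂ Prod.fst Prod.snd L₂ c₂ x w
  obtain ⟨g₃, hg₃⟩ : ∃ g : (Fin V → ZMod 2) → ZMod 2, ∀ x, g x = f₁ x + f₂ x := ⟨_, fun _ => rfl⟩
  have hq₃ : ∀ x w, g₃ (x + w) = g₃ x + g₃ w - g₃ 0 + polar (T₁ ∆ T₂) Prod.fst Prod.snd x w := by
    intro x w; simp only [hg₃]; rw [polar_symmDiff, hq₁, hq₂]; ring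
  have hT₃E : T₁ ∆ T₂ ⊆ E := fun j hj => by
    rcases mem_symmDiff.1 hj with h | h
    exacts [hT₁E h.1, hT₂E h.1]
  have hcov := mem_or_mem hunsat hmin
  -- the count for `T₁` from the isotropy of `D`
  have hT₁ : T₁.card ≤ 2 * Δ ^ 2 * (V - finrank (ZMod 2) D) := card_le_of_isotropic_sub Δ hS hΔ hT₁E hD₁
  -- the packages of `T₂` and `T₁ △ T₂`
  obtain ⟨n₂, hn₂d, hT₂, hε₂, hiso₂⟩ := form_package Δ hS hΔ hT₂E D 𝒟 h𝒟 f₂ hq₂ b₀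
  obtain ⟨n₃, hn₃d, hT₃, hε₃, hiso₃⟩ := form_package Δ hS hΔ hT₃E D 𝒟 h𝒟 g₃ hq₃ b₀
  have h𝒟c : (𝒟.card : ℤ) = 2 ^ finrank (ZMod 2) D := by exact_mod_cast card_eq_two_pow_finrank D 𝒟 h𝒟
  have hcard := card_le_abs_add 𝒟 (fun u => f₁ (b₀ + u)) (fun u => f₂ (b₀ + u)) fun u hu => hunsat u ((h𝒟 u).1 hu)
  simp only [← hg₃] at hcard
  -- dichotomy for the affine `f₁`
  rcases affine_dichotomy D 𝒟 h𝒟 f₁ hq₁ b₀ hD₁ with hε₁ | hconst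
  · -- bias of `f₁` vanishes: two-term count
    rw [hε₁, abs_zero, zero_add] at hcard
    have hpow : 2 ^ finrank (ZMod 2) D ≤ 2 ^ n₂ + 2 ^ n₃ := by
      have : (2 : ℤ) ^ finrank (ZMod 2) D ≤ 2 ^ n₂ + 2 ^ n₃ := by rw [← h𝒟c]; linarith
      exact_mod_cast this
    rcases pow_two_cases hn₂d hn₃d hpow with h2 | h3 | ⟨h2, h3⟩
    · -- `D` isotropic for `B₂` too
      have hT₂' : T₂.card ≤ 2 * Δ ^ 2 * (V - finrank (ZMod 2) D) := card_le_of_isotropic_sub Δ hS hΔ hT₂E (hiso₂ h2)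
      have hE : E.card ≤ T₁.card + T₂.card :=
        (card_le_card fun j hj => mem_union.2 (hcov j hj)).trans (card_union_le _ _)
      have : T₁.card + T₂.card ≤ 2 * Δ ^ 2 * ((V - finrank (ZMod 2) D) + (V - finrank (ZMod 2) D)) := by
        rw [mul_add]; exact add_le_add hT₁ hT₂'
      exact hE.trans (this.trans (Nat.mul_le_mul_left _ (by omega)))
    · -- `D` isotropic for `B₁ + B₂`, hence for `B₂`
      have hD₂ : ∀ u ∈ D, ∀ v ∈ D, polar T₂ Prod.fst Prod.snd u v = 0 := by
        intro u hu v hv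
        have e := polar_symmDiff T₁ T₂ u v
        rw [hiso₃ h3 u hu v hv, hD₁ u hu v hv, zero_add] at e
        exact e.symm
      have hT₂' : T₂.card ≤ 2 * Δ ^ 2 * (V - finrank (ZMod 2) D) := card_le_of_isotropic_sub Δ hS hΔ hT₂E hD₂
      have hE : E.card ≤ T₁.card + T₂.card :=
        (card_le_card fun j hj => mem_union.2 (hcov j hj)).trans (card_union_le _ _)
      have : T₁.card + T₂.card ≤ 2 * Δ ^ 2 * ((V - finrank (ZMod 2) D) + (V - finrank (ZMod 2) D)) := by
        rw [mul_add]; exact add_le_add hT₁ hT₂'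
      exact hE.trans (this.trans (Nat.mul_le_mul_left _ (by omega)))
    · -- `n₂ = n₃ = dim D − 1`
      have hE : E.card ≤ T₁.card + T₂.card :=
        (card_le_card fun j hj => mem_union.2 (hcov j hj)).trans (card_union_le _ _)
      have : T₁.card + T₂.card ≤ 2 * Δ ^ 2 * ((V - finrank (ZMod 2) D) + (V - n₂)) := by
        rw [mul_add]; exact add_le_add hT₁ hT₂
      exact hE.trans (this.trans (Nat.mul_le_mul_left _ (by omega)))
  · -- `f₁` constant on the coset
    by_cases hγ : f₁ b₀ = 0
    · -- `w₁` holds everywhere, so `w₂` fails everywhere: `f₂ ≡ 1`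
      have hf₂one : ∀ u ∈ D, f₂ (b₀ + u) = 1 := by
        intro u hu
        rcases hunsat u hu with h | h
        · exact absurd ((hconst u hu).trans hγ) h
        · exact zmod2_eq_one_of_ne_zero h
      have hconst₂ : ∀ u ∈ D, f₂ (b₀ + u) = f₂ b₀ := by
        intro u hu
        rw [hf₂one u hu, ← hf₂one 0 D.zero_mem, add_zero]
      have hD₂ := const_iso D f₂ L₂ c₂ hf₂ b₀ hconst₂
      have hT₂' : T₂.card ≤ 2 * Δ ^ 2 * (V - finrank (ZMod 2) D) := card_le_of_isotropic_sub Δ hS hΔ hT₂E hD₂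
      have hE : E ⊆ T₂ := by
        intro j hj
        obtain ⟨u, hu, -, h2⟩ := hmin j hj
        by_contra hjT
        have := h2.2 hjT
        rw [hf₂one u hu] at this
        exact one_ne_zero this
      exact (card_le_card hE).trans (hT₂'.trans (Nat.mul_le_mul_left _ (by omega)))
    · -- `w₁` fails everywhere: `E ⊆ T₁`
      have hE : E ⊆ T₁ := by
        intro j hj
        obtain ⟨u, hu, h1, -⟩ := hmin j hj
        by_contra hjT
        exact hγ ((hconst u hu).symm.trans (h1.2 hjT))
      exact (card_le_card hE).trans (hT₁.trans (Nat.mul_le_mul_left _ (by omega)))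

/-- **The isotropic case for `T₁ △ T₂`.**  If `D` is isotropic for `B_{T₁} + B_{T₂}` then `|E| ≤ 2Δ²(2t + 3)`. -/
theorem case_iso_symmDiff (hS : Simple E) (hΔ : EdgeMaxDegree Δ E) (hT₁E : T₁ ⊆ E) (hT₂E : T₂ ⊆ E)
    (𝒟 : Finset (Fin V → ZMod 2)) (h𝒟 : ∀ x, x ∈ 𝒟 ↔ x ∈ D) (hcodim : V ≤ finrank (ZMod 2) D + t)
    (hf₁ : ∀ x, f₁ x = qform T₁ Prod.fst Prod.snd x + L₁ x + c₁)
    (hf₂ : ∀ x, f₂ x = qform T₂ Prod.fst Prod.snd x + L₂ x + c₂)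
    (hunsat : ∀ u ∈ D, f₁ (b₀ + u) ≠ 0 ∨ f₂ (b₀ + u) ≠ 0)
    (hmin : ∀ j ∈ E, ∃ u ∈ D, (f₁ (b₀ + u) = 0 ↔ j ∉ T₁) ∧ (f₂ (b₀ + u) = 0 ↔ j ∉ T₂))
    (hD₃ : ∀ u ∈ D, ∀ v ∈ D, polar (T₁ ∆ T₂) Prod.fst Prod.snd u v = 0) :
    E.card ≤ 2 * Δ ^ 2 * (2 * t + 3) := by
  classical
  have hdV : finrank (ZMod 2) D ≤ V := by simpa using Submodule.finrank_le D
  have hq₁ : ∀ x w, f₁ (x + w) = f₁ x + f₁ w - f₁ 0 + polar T₁ Prod.fst Prod.snd x w := by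
    intro x w; simp only [hf₁]; exact quadratic_of_qform T₁ Prod.fst Prod.snd L₁ c₁ x w
  have hq₂ : ∀ x w, f₂ (x + w) = f₂ x + f₂ w - f₂ 0 + polar T₂ Prod.fst Prod.snd x w := by
    intro x w; simp only [hf₂]; exact quadratic_of_qform T₂ Prod.fst Prod.snd L₂ c₂ x w
  obtain ⟨g₃, hg₃⟩ : ∃ g : (Fin V → ZMod 2) → ZMod 2, ∀ x, g x = f₁ x + f₂ x := ⟨_, fun _ => rfl⟩
  have hq₃ : ∀ x w, g₃ (x + w) = g₃ x + g₃ w - g₃ 0 + polar (T₁ ∆ T₂) Prod.fst Prod.snd x w := by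
    intro x w; simp only [hg₃]; rw [polar_symmDiff, hq₁, hq₂]; ring
  have hg₃def : ∀ x, g₃ x = qform (T₁ ∆ T₂) Prod.fst Prod.snd x + (L₁ + L₂) x + (c₁ + c₂) := by
    intro x; rw [hg₃, hf₁, hf₂, qform_symmDiff, LinearMap.add_apply]; ring
  have hT₃E : T₁ ∆ T₂ ⊆ E := fun j hj => by
    rcases mem_symmDiff.1 hj with h | h
    exacts [hT₁E h.1, hT₂E h.1]
  have hcov := mem_or_mem hunsat hmin
  have hT₃ : (T₁ ∆ T₂).card ≤ 2 * Δ ^ 2 * (V - finrank (ZMod 2) D) := card_le_of_isotropic_sub Δ hS hΔ hT₃E hD₃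
  obtain ⟨n₁, hn₁d, hT₁, hε₁, hiso₁⟩ := form_package Δ hS hΔ hT₁E D 𝒟 h𝒟 f₁ hq₁ b₀
  obtain ⟨n₂, hn₂d, hT₂, hε₂, hiso₂⟩ := form_package Δ hS hΔ hT₂E D 𝒟 h𝒟 f₂ hq₂ b₀
  have h𝒟c : (𝒟.card : ℤ) = 2 ^ finrank (ZMod 2) D := by exact_mod_cast card_eq_two_pow_finrank D 𝒟 h𝒟
  have hcard := card_le_abs_add 𝒟 (fun u => f₁ (b₀ + u)) (fun u => f₂ (b₀ + u)) fun u hu => hunsat u ((h𝒟 u).1 hu)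
  simp only [← hg₃] at hcard
  have hE12 : E.card ≤ T₁.card + T₂.card :=
    (card_le_card fun j hj => mem_union.2 (hcov j hj)).trans (card_union_le _ _)
  -- both `B₁` and `B₂` isotropic on `D` as soon as one of them is
  have both : (∀ u ∈ D, ∀ v ∈ D, polar T₁ Prod.fst Prod.snd u v = 0) ∨
      (∀ u ∈ D, ∀ v ∈ D, polar T₂ Prod.fst Prod.snd u v = 0) → E.card ≤ 2 * Δ ^ 2 * (2 * t + 3) := by
    intro h
    have hD₁ : ∀ u ∈ D, ∀ v ∈ D, polar T₁ Prod.fst Prod.snd u v = 0 := by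
      rcases h with h | h
      · exact h
      · intro u hu v hv
        have e := polar_symmDiff T₁ T₂ u v
        rw [hD₃ u hu v hv, h u hu v hv, add_zero] at e
        exact e.symm
    have hD₂ : ∀ u ∈ D, ∀ v ∈ D, polar T₂ Prod.fst Prod.snd u v = 0 := by
      intro u hu v hv
      have e := polar_symmDiff T₁ T₂ u v
      rw [hD₃ u hu v hv, hD₁ u hu v hv, zero_add] at e
      exact e.symm
    have hT₁' := card_le_of_isotropic_sub Δ hS hΔ hT₁E hD₁
    have hT₂' := card_le_of_isotropic_sub Δ hS hΔ hT₂E hD₂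
    have : T₁.card + T₂.card ≤ 2 * Δ ^ 2 * ((V - finrank (ZMod 2) D) + (V - finrank (ZMod 2) D)) := by
      rw [mul_add]; exact add_le_add hT₁' hT₂'
    exact hE12.trans (this.trans (Nat.mul_le_mul_left _ (by omega)))
  rcases affine_dichotomy D 𝒟 h𝒟 g₃ hq₃ b₀ hD₃ with hε₃ | hconst
  · -- bias of `f₁ + f₂` vanishes
    rw [hε₃, abs_zero, add_zero] at hcard
    have hpow : 2 ^ finrank (ZMod 2) D ≤ 2 ^ n₁ + 2 ^ n₂ := by
      have : (2 : ℤ) ^ finrank (ZMod 2) D ≤ 2 ^ n₁ + 2 ^ n₂ := by rw [← h𝒟c]; linarith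
      exact_mod_cast this
    rcases pow_two_cases hn₁d hn₂d hpow with h1 | h2 | ⟨h1, h2⟩
    · exact both (Or.inl (hiso₁ h1))
    · exact both (Or.inr (hiso₂ h2))
    · have : T₁.card + T₂.card ≤ 2 * Δ ^ 2 * ((V - n₁) + (V - n₂)) := by
        rw [mul_add]; exact add_le_add hT₁ hT₂
      exact hE12.trans (this.trans (Nat.mul_le_mul_left _ (by omega)))
  · -- `f₁ + f₂` constant on the coset
    by_cases hγ : g₃ b₀ = 0
    · -- `f₁ = f₂` there; unsat forces `f₁ ≡ 1`: constant, and `E ⊆ T₁`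
      have hf₁one : ∀ u ∈ D, f₁ (b₀ + u) = 1 := by
        intro u hu
        have e : f₁ (b₀ + u) + f₂ (b₀ + u) = 0 := by rw [← hg₃, hconst u hu, hγ]
        rcases hunsat u hu with h | h
        · exact zmod2_eq_one_of_ne_zero h
        · have h2 := zmod2_eq_one_of_ne_zero h
          rw [h2] at e
          have h11 := zmod2_add_self (1 : ZMod 2)
          linear_combination e - h11
      have hconst₁ : ∀ u ∈ D, f₁ (b₀ + u) = f₁ b₀ := by
        intro u hu
        rw [hf₁one u hu, ← hf₁one 0 D.zero_mem, add_zero]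
      have hD₁ := const_iso D f₁ L₁ c₁ hf₁ b₀ hconst₁
      have hE : E ⊆ T₁ := by
        intro j hj
        obtain ⟨u, hu, h1, -⟩ := hmin j hj
        by_contra hjT
        have := h1.2 hjT
        rw [hf₁one u hu] at this
        exact one_ne_zero this
      have hT₁' := card_le_of_isotropic_sub Δ hS hΔ hT₁E hD₁
      exact (card_le_card hE).trans (hT₁'.trans (Nat.mul_le_mul_left _ (by omega)))
    · -- `f₁ + f₂ ≡ γ ≠ 0`: no edge lies in `T₁ ∩ T₂`, so `E ⊆ T₁ △ T₂`
      have hE : E ⊆ T₁ ∆ T₂ := by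
        intro j hj
        obtain ⟨u, hu, h1, h2⟩ := hmin j hj
        rw [mem_symmDiff]
        rcases hcov j hj with hj₁ | hj₂
        · refine Or.inl ⟨hj₁, fun hj₂ => hγ ?_⟩
          have e1 := zmod2_eq_one_of_ne_zero fun h => (h1.1 h) hj₁
          have e2 := zmod2_eq_one_of_ne_zero fun h => (h2.1 h) hj₂
          rw [← hconst u hu, hg₃, e1, e2]
          decide
        · refine Or.inr ⟨hj₂, fun hj₁ => hγ ?_⟩
          have e1 := zmod2_eq_one_of_ne_zero fun h => (h1.1 h) hj₁
          have e2 := zmod2_eq_one_of_ne_zero fun h => (h2.1 h) hj₂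
          rw [← hconst u hu, hg₃, e1, e2]
          decide
      exact (card_le_card hE).trans (hT₃.trans (Nat.mul_le_mul_left _ (by omega)))

/-- **Two quadratic forms on a bounded-degree graph.**  With the notation of the module docstring:
`|E| ≤ 2Δ² · (2t + 3)`. -/
theorem two_forms_bound (hS : Simple E) (hΔ : EdgeMaxDegree Δ E) (hT₁E : T₁ ⊆ E) (hT₂E : T₂ ⊆ E)
    (hcodim : V ≤ finrank (ZMod 2) D + t)
    (hf₁ : ∀ x, f₁ x = qform T₁ Prod.fst Prod.snd x + L₁ x + c₁)
    (hf₂ : ∀ x, f₂ x = qform T₂ Prod.fst Prod.snd x + L₂ x + c₂)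
    (hunsat : ∀ u ∈ D, f₁ (b₀ + u) ≠ 0 ∨ f₂ (b₀ + u) ≠ 0)
    (hmin : ∀ j ∈ E, ∃ u ∈ D, (f₁ (b₀ + u) = 0 ↔ j ∉ T₁) ∧ (f₂ (b₀ + u) = 0 ↔ j ∉ T₂)) :
    E.card ≤ 2 * Δ ^ 2 * (2 * t + 3) := by
  classical
  obtain ⟨𝒟, h𝒟⟩ : ∃ 𝒟 : Finset (Fin V → ZMod 2), ∀ x, x ∈ 𝒟 ↔ x ∈ D := ⟨univ.filter (· ∈ D), fun x => by simp⟩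
  have hdV : finrank (ZMod 2) D ≤ V := by simpa using Submodule.finrank_le D
  have hq₁ : ∀ x w, f₁ (x + w) = f₁ x + f₁ w - f₁ 0 + polar T₁ Prod.fst Prod.snd x w := by
    intro x w; simp only [hf₁]; exact quadratic_of_qform T₁ Prod.fst Prod.snd L₁ c₁ x w
  have hq₂ : ∀ x w, f₂ (x + w) = f₂ x + f₂ w - f₂ 0 + polar T₂ Prod.fst Prod.snd x w := by
    intro x w; simp only [hf₂]; exact quadratic_of_qform T₂ Prod.fst Prod.snd L₂ c₂ x w
  obtain ⟨g₃, hg₃⟩ : ∃ g : (Fin V → ZMod 2) → ZMod 2, ∀ x, g x = f₁ x + f₂ x := ⟨_, fun _ => rfl⟩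
  have hq₃ : ∀ x w, g₃ (x + w) = g₃ x + g₃ w - g₃ 0 + polar (T₁ ∆ T₂) Prod.fst Prod.snd x w := by
    intro x w; simp only [hg₃]; rw [polar_symmDiff, hq₁, hq₂]; ring
  have hT₃E : T₁ ∆ T₂ ⊆ E := fun j hj => by
    rcases mem_symmDiff.1 hj with h | h
    exacts [hT₁E h.1, hT₂E h.1]
  have hcov := mem_or_mem hunsat hmin
  obtain ⟨n₁, hn₁d, hT₁, hε₁, hiso₁⟩ := form_package Δ hS hΔ hT₁E D 𝒟 h𝒟 f₁ hq₁ b₀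
  obtain ⟨n₂, hn₂d, hT₂, hε₂, hiso₂⟩ := form_package Δ hS hΔ hT₂E D 𝒟 h𝒟 f₂ hq₂ b₀
  obtain ⟨n₃, hn₃d, hT₃, hε₃, hiso₃⟩ := form_package Δ hS hΔ hT₃E D 𝒟 h𝒟 g₃ hq₃ b₀
  have h𝒟c : (𝒟.card : ℤ) = 2 ^ finrank (ZMod 2) D := by exact_mod_cast card_eq_two_pow_finrank D 𝒟 h𝒟
  have hcard := card_le_abs_add 𝒟 (fun u => f₁ (b₀ + u)) (fun u => f₂ (b₀ + u)) fun u hu => hunsat u ((h𝒟 u).1 hu)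
  simp only [← hg₃] at hcard
  have hpow : 2 ^ finrank (ZMod 2) D ≤ 2 ^ n₁ + 2 ^ n₂ + 2 ^ n₃ := by
    have : (2 : ℤ) ^ finrank (ZMod 2) D ≤ 2 ^ n₁ + 2 ^ n₂ + 2 ^ n₃ := by rw [← h𝒟c]; linarith
    exact_mod_cast this
  -- coverings by pairs of forms
  have hE12 : E.card ≤ T₁.card + T₂.card :=
    (card_le_card fun j hj => mem_union.2 (hcov j hj)).trans (card_union_le _ _)
  have hE13 : E.card ≤ T₁.card + (T₁ ∆ T₂).card := by
    refine (card_le_card fun j hj => mem_union.2 ?_).trans (card_union_le _ _)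
    by_cases h1 : j ∈ T₁
    · exact Or.inl h1
    · exact Or.inr (mem_symmDiff.2 (Or.inr ⟨(hcov j hj).resolve_left h1, h1⟩))
  have hE23 : E.card ≤ T₂.card + (T₁ ∆ T₂).card := by
    refine (card_le_card fun j hj => mem_union.2 ?_).trans (card_union_le _ _)
    by_cases h2 : j ∈ T₂
    · exact Or.inl h2
    · exact Or.inr (mem_symmDiff.2 (Or.inl ⟨(hcov j hj).resolve_right h2, h2⟩))
  rcases pow_three_cases hn₁d hn₂d hn₃d hpow with h | h | h | h | h | h
  · exact case_iso hS hΔ hT₁E hT₂E 𝒟 h𝒟 hcodim hf₁ hf₂ hunsat hmin (hiso₁ h)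
  · -- swap the roles of the two forms
    have h' := case_iso (T₁ := T₂) (T₂ := T₁) (f₁ := f₂) (f₂ := f₁) (t := t) hS hΔ hT₂E hT₁E 𝒟 h𝒟 hcodim hf₂ hf₁
      (fun u hu => (hunsat u hu).symm) (fun j hj => by
        obtain ⟨u, hu, h1, h2⟩ := hmin j hj
        exact ⟨u, hu, h2, h1⟩) (hiso₂ h)
    exact h'
  · exact case_iso_symmDiff hS hΔ hT₁E hT₂E 𝒟 h𝒟 hcodim hf₁ hf₂ hunsat hmin (hiso₃ h)
  · have : T₁.card + T₂.card ≤ 2 * Δ ^ 2 * ((V - n₁) + (V - n₂)) := by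
      rw [mul_add]; exact add_le_add hT₁ hT₂
    exact hE12.trans (this.trans (Nat.mul_le_mul_left _ (by omega)))
  · have : T₁.card + (T₁ ∆ T₂).card ≤ 2 * Δ ^ 2 * ((V - n₁) + (V - n₃)) := by
      rw [mul_add]; exact add_le_add hT₁ hT₃
    exact hE13.trans (this.trans (Nat.mul_le_mul_left _ (by omega)))
  · have : T₂.card + (T₁ ∆ T₂).card ≤ 2 * Δ ^ 2 * ((V - n₂) + (V - n₃)) := by
      rw [mul_add]; exact add_le_add hT₂ hT₃
    exact hE23.trans (this.trans (Nat.mul_le_mul_left _ (by omega)))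

end Summit.PneNP.PneNP.Theorems.PstarGraphQuadGapTwoCases
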